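import Literature.AlgebraicGeometry.Limits.FiniteTypeModelDescent
import HarnessLib

/-!
# Spreading out morphisms along `B = ⋃ K[t]`: schemes of finite type over `X₀ ×_K Spec B` come from a stage

Topic: `Literature/AlgebraicGeometry/Limits` (EGA IV₃ Thm. 8.8.2; The Stacks Project, Tags 01ZC,
01ZM; Görtz–Wedhorn I, Thm. 10.57, Thm. 10.66).  Sequel of `Limits/SubalgebraDiagram`
(`(P ⊗ Spec B).left = lim_t (P ⊗ Spec K[t]).left` over the finite subsets `t ⊆ B`) and
`Limits/FiniteTypeModelDescent` (separated schemes of finite type over `B` come from a finitely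
generated subalgebra).

* `SubalgApprox.exists_π_app_comp_eq` — **Stacks 01ZC, surjectivity, for the subalgebra diagram**:
  every morphism `(P ⊗ Spec B).left → Y` over a base `S` into an `S`-scheme `Y` locally of finite
  presentation is the restriction of a morphism `(P ⊗ Spec K[t]).left → Y` over `S`, `P`
  quasi-compact and quasi-separated over `K` (Mathlib
  `Scheme.exists_π_app_comp_eq_of_locallyOfFinitePresentation` for `isLimitProdCone`);
* `SubalgApprox.exists_map_comp_eq_comp` — **Stacks 01ZC, injectivity**: two such extensions agree
  over a finer stage;
* `exists_isPullback_whisker_of_hom_tensorObj` — **schemes separated and of finite type over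
  `X₀ ×_K Spec B` come from a stage**: for a `K`-scheme `X₀` quasi-compact, separated and locally of
  finite presentation over `K`, a `K`-algebra `B` which is a Noetherian ring (e.g. a field extension
  of the field `K`) and a separated morphism of finite type `a : X → X₀ ×_K Spec B`, there are a
  `K`-algebra `R` of finite type with an injective `K`-algebra map `ψ : R → B`, a separated morphism
  of finite type `G : X' → X₀ ×_K Spec R` and `π : X → X'` exhibiting `a` as the base change of `G`
  along `X₀ ×_K Spec B → X₀ ×_K Spec R` (EGA IV₃ 8.8.2 (ii) for `X₀ ×_K Spec B = lim X₀ ×_K Spec R`: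
  first `X` itself comes from a finitely generated subalgebra `R₁ ⊆ B`
  (`exists_isPullback_specMap_subalgebra`), then the morphism to `X₀` spreads to a stage
  `R = R₁[t]` by 01ZC).  This is the algebraic "spreading out" of a morphism of complex varieties
  — e.g. of a finite étale cover of `S₀ ⊗_{ℚ̄} ℂ` — over a `ℚ̄`-variety with function field inside
  `ℂ` (Voisin, *Hodge loci and absolute Hodge classes* (2007), §3; Charles–Schnell, *Notes on
  absolute Hodge classes*, §11.3.5), WITHOUT the finiteness / étaleness of the spread morphism,
  which are further steps (EGA IV₃ 8.10.5, IV₄ 17.7.8).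

Everything is proved; no definitions, no named facts.

## References

* A. Grothendieck, J. Dieudonné, EGA IV₃, Publ. Math. IHÉS 28 (1966), Thm. 8.8.2. [EGAIV3]
* The Stacks Project, Tags 01ZC, 01ZM. [StacksProject]
* U. Görtz, T. Wedhorn, *Algebraic Geometry I: Schemes*, 2nd ed. (2020), Thm. 10.57, Thm. 10.66.
  [GortzWedhorn2020]
-/

noncomputable section

universe u

open CategoryTheory CategoryTheory.Limits AlgebraicGeometry Opposite MonoidalCategory

namespace Literature.AlgebraicGeometry.Limits

open Literature.AlgebraicGeometry.Motives (SchemeOver specOver)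

set_option backward.isDefEq.respectTransparency false

namespace SubalgApprox

variable {K B : Type u} [CommRing K] [CommRing B] [Algebra K B] (s₁ : Finset B) (P : SchemeOver K)

/-- **Stacks 01ZC (surjectivity) for `(P ⊗ Spec B).left = lim_t (P ⊗ Spec K[t]).left`.** Let `P` be
quasi-compact and quasi-separated over `K`, `κ : Spec K → S` a base, `f : Y → S` locally of finite
presentation. Every morphism `a : (P ⊗ Spec B).left → Y` over `S` is the restriction of a morphism
`g : (P ⊗ Spec K[t]).left → Y` over `S` for some finite `t ⊆ B` (Mathlib
`Scheme.exists_π_app_comp_eq_of_locallyOfFinitePresentation` applied to `isLimitProdCone`).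
[cite: StacksProject, Tag 01ZC] [cite: GortzWedhorn2020, Thm. 10.57] -/
theorem exists_π_app_comp_eq [QuasiCompact P.hom] [QuasiSeparated P.hom] {S Y : Scheme.{u}}
    (κ : Spec (.of K) ⟶ S) (f : Y ⟶ S) [LocallyOfFinitePresentation f]
    (a : (P ⊗ specOver K B).left ⟶ Y) (ha : a ≫ f = (P ⊗ specOver K B).hom ≫ κ) :
    ∃ (t : (Idx B s₁)ᵒᵖ) (g : (P ⊗ (baseDiagram K B s₁).obj t).left ⟶ Y),
      (prodCone K B s₁ P).π.app t ≫ g = a ∧ g ≫ f = (P ⊗ (baseDiagram K B s₁).obj t).hom ≫ κ := by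
  -- the structure maps to `S`, as a natural transformation to the constant diagram
  let τ : prodDiagram K B s₁ P ⟶ (Functor.const (Idx B s₁)ᵒᵖ).obj S :=
    { app := fun t ↦ (P ⊗ (baseDiagram K B s₁).obj t).hom ≫ κ
      naturality := fun t t' φ ↦ by
        change (P ◁ (baseDiagram K B s₁).map φ).left ≫ (P ⊗ (baseDiagram K B s₁).obj t').hom ≫ κ =
          ((P ⊗ (baseDiagram K B s₁).obj t).hom ≫ κ) ≫ 𝟙 _
        rw [Over.w_assoc, Category.comp_id] }
  have hτ : (prodCone K B s₁ P).π ≫ τ = (Functor.const (Idx B s₁)ᵒᵖ).map (a ≫ f) := by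
    ext t
    change (P ◁ (baseCone K B s₁).π.app t).left ≫ (P ⊗ (baseDiagram K B s₁).obj t).hom ≫ κ = a ≫ f
    rw [Over.w_assoc, ha]
    rfl
  obtain ⟨t, g, hg, hg'⟩ := Scheme.exists_π_app_comp_eq_of_locallyOfFinitePresentation
    (prodDiagram K B s₁ P) τ f (prodCone K B s₁ P) (isLimitProdCone K B s₁ P) a hτ
  exact ⟨t, g, hg, hg'⟩

/-- **Stacks 01ZC (injectivity) for the subalgebra diagram.** Let `P` be quasi-compact and
quasi-separated over `K` and `f : Y → S` locally of finite type. Two morphisms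
`(P ⊗ Spec K[t]).left → Y` over `S` which agree on `(P ⊗ Spec B).left` agree on
`(P ⊗ Spec K[t']).left` for some `t' ⊇ t` (Mathlib
`Scheme.exists_hom_comp_eq_comp_of_locallyOfFiniteType`). [cite: StacksProject, Tag 01ZC]
[cite: GortzWedhorn2020, Thm. 10.57] -/
theorem exists_map_comp_eq_comp [QuasiCompact P.hom] [QuasiSeparated P.hom] {S Y : Scheme.{u}}
    (κ : Spec (.of K) ⟶ S) (f : Y ⟶ S) [LocallyOfFiniteType f] {t : (Idx B s₁)ᵒᵖ}
    (g₁ g₂ : (P ⊗ (baseDiagram K B s₁).obj t).left ⟶ Y)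
    (hg₁ : g₁ ≫ f = (P ⊗ (baseDiagram K B s₁).obj t).hom ≫ κ)
    (hg₂ : g₂ ≫ f = (P ⊗ (baseDiagram K B s₁).obj t).hom ≫ κ)
    (h : (prodCone K B s₁ P).π.app t ≫ g₁ = (prodCone K B s₁ P).π.app t ≫ g₂) :
    ∃ (t' : (Idx B s₁)ᵒᵖ) (φ : t' ⟶ t),
      (prodDiagram K B s₁ P).map φ ≫ g₁ = (prodDiagram K B s₁ P).map φ ≫ g₂ := by
  let τ : prodDiagram K B s₁ P ⟶ (Functor.const (Idx B s₁)ᵒᵖ).obj S :=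
    { app := fun t ↦ (P ⊗ (baseDiagram K B s₁).obj t).hom ≫ κ
      naturality := fun t t' φ ↦ by
        change (P ◁ (baseDiagram K B s₁).map φ).left ≫ (P ⊗ (baseDiagram K B s₁).obj t').hom ≫ κ =
          ((P ⊗ (baseDiagram K B s₁).obj t).hom ≫ κ) ≫ 𝟙 _
        rw [Over.w_assoc, Category.comp_id] }
  obtain ⟨t', φ, e⟩ := Scheme.exists_hom_comp_eq_comp_of_locallyOfFiniteType
    (prodDiagram K B s₁ P) τ f (prodCone K B s₁ P) (isLimitProdCone K B s₁ P) (i := t)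
    g₁ g₂ hg₁.symm hg₂.symm h
  exact ⟨t', φ, e⟩

end SubalgApprox

/-! ## Separated schemes of finite type over `X₀ ×_K Spec B` come from a stage -/

/-- **Separated morphisms of finite type into `X₀ ×_K Spec B` come from a finitely generated
`K`-subalgebra of `B`** (EGA IV₃ 8.8.2 (ii), Stacks 01ZM + 01ZC for
`X₀ ×_K Spec B = lim X₀ ×_K Spec R`). Let `X₀` be a quasi-compact separated `K`-scheme locally of
finite presentation, `B` a `K`-algebra which is a Noetherian ring, and `a : X → X₀ ×_K Spec B`
separated and of finite type. Then there are a `K`-algebra `R` of finite type with an injective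
`K`-algebra map `ψ : R → B`, a separated morphism of finite type `G : X' → X₀ ×_K Spec R`, a
morphism `π : X → X'` and the base change map `ℓ : X₀ ×_K Spec B → X₀ ×_K Spec R` (characterised by
its two components) such that the square `(π, a; G, ℓ)` is cartesian: `a` is the base change of
`G` along `Spec ψ`. [cite: EGAIV3, Thm. 8.8.2 (ii)] [cite: StacksProject, Tags 01ZM and 01ZC]
[cite: GortzWedhorn2020, Thm. 10.66] -/
theorem exists_isPullback_whisker_of_hom_tensorObj {K B : Type u} [CommRing K] [CommRing B]
    [Algebra K B] [IsNoetherianRing B] (X₀ : SchemeOver K) [QuasiCompact X₀.hom]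
    [IsSeparated X₀.hom] [LocallyOfFinitePresentation X₀.hom] {X : Scheme.{u}}
    (a : X ⟶ (X₀ ⊗ specOver K B).left) [IsSeparated a] [LocallyOfFiniteType a] [QuasiCompact a] :
    ∃ (R : Type u) (_ : CommRing R) (_ : Algebra K R) (ψ : R →ₐ[K] B) (X' : Scheme.{u})
      (G : X' ⟶ (X₀ ⊗ specOver K R).left) (π : X ⟶ X')
      (ℓ : (X₀ ⊗ specOver K B).left ⟶ (X₀ ⊗ specOver K R).left),
      Function.Injective ψ ∧ Algebra.FiniteType K R ∧ IsSeparated G ∧ LocallyOfFiniteType G ∧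
        QuasiCompact G ∧ ℓ ≫ pullback.fst _ _ = pullback.fst _ _ ∧
        ℓ ≫ pullback.snd _ _ = pullback.snd _ _ ≫ Spec.map (CommRingCat.ofHom ψ.toRingHom) ∧
        IsPullback π a G ℓ := by
  classical
  -- the structure map `g : X → Spec B`, separated of finite type
  let g : X ⟶ Spec (.of B) := a ≫ pullback.snd X₀.hom (specOver K B).hom
  haveI : IsSeparated (pullback.snd X₀.hom (specOver K B).hom) := inferInstance
  haveI : IsSeparated g := inferInstance
  haveI : LocallyOfFiniteType g := inferInstance
  haveI : QuasiCompact g := inferInstance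
  -- 1. `X` comes from a finitely generated `K`-subalgebra `R₁ ⊆ B`
  obtain ⟨R₁, X₁, p₁, π₁, hR₁, hsep, hlft, hqc, hsq₁⟩ := exists_isPullback_specMap_subalgebra (K := K) g
  haveI := hsep
  haveI := hlft
  haveI := hqc
  obtain ⟨s₁, rfl⟩ := hR₁
  -- 2. the limit presentation `X = X₁ ×_{R₁} Spec B = lim_t X₁ ×_{R₁} Spec R₁[t]`
  let P₁ : SchemeOver (Algebra.adjoin K (s₁ : Set B)) := Over.mk p₁
  haveI : QuasiCompact P₁.hom := hqc
  haveI : IsSeparated P₁.hom := hsep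
  haveI : LocallyOfFiniteType P₁.hom := hlft
  haveI : QuasiSeparated P₁.hom := inferInstanceAs (QuasiSeparated p₁)
  let c := SubalgApprox.prodCone (Algebra.adjoin K (s₁ : Set B)) B (∅ : Finset B) P₁
  -- `X ≅ c.pt` (both are `X₁ ×_{R₁} Spec B`)
  have hsq₁' : IsPullback π₁ g p₁ (specOver (Algebra.adjoin K (s₁ : Set B)) B).hom := hsq₁
  let e : X ≅ c.pt := hsq₁'.isoPullback
  have he₁ : e.hom ≫ pullback.fst _ _ = π₁ := hsq₁'.isoPullback_hom_fst
  have he₂ : e.hom ≫ pullback.snd _ _ = g := hsq₁'.isoPullback_hom_snd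
  -- 3. the morphism `X → X₀` over `Spec K` spreads to a stage (Stacks 01ZC)
  let a' : c.pt ⟶ X₀.left := e.inv ≫ a ≫ pullback.fst X₀.hom (specOver K B).hom
  have h1 : a ≫ pullback.fst X₀.hom (specOver K B).hom ≫ X₀.hom =
      g ≫ Spec.map (CommRingCat.ofHom (algebraMap K B)) := by
    rw [pullback.condition]
    rfl
  have h2 : (P₁ ⊗ specOver (Algebra.adjoin K (s₁ : Set B)) B).hom ≫
      Spec.map (CommRingCat.ofHom (algebraMap K (Algebra.adjoin K (s₁ : Set B)))) =
        pullback.snd P₁.hom (specOver (Algebra.adjoin K (s₁ : Set B)) B).hom ≫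
          Spec.map (CommRingCat.ofHom (algebraMap K B)) := by
    rw [Over.tensorObj_hom, Category.assoc, pullback.condition_assoc]
    change pullback.snd P₁.hom (specOver (Algebra.adjoin K (s₁ : Set B)) B).hom ≫
      Spec.map (CommRingCat.ofHom (algebraMap (Algebra.adjoin K (s₁ : Set B)) B)) ≫
        Spec.map (CommRingCat.ofHom (algebraMap K (Algebra.adjoin K (s₁ : Set B)))) = _
    rw [← Spec.map_comp, ← CommRingCat.ofHom_comp,
      ← IsScalarTower.algebraMap_eq K (Algebra.adjoin K (s₁ : Set B)) B]
  have ha' : a' ≫ X₀.hom = (P₁ ⊗ specOver (Algebra.adjoin K (s₁ : Set B)) B).hom ≫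
      Spec.map (CommRingCat.ofHom (algebraMap K (Algebra.adjoin K (s₁ : Set B)))) := by
    have h3 : e.inv ≫ g ≫ Spec.map (CommRingCat.ofHom (algebraMap K B)) =
        pullback.snd P₁.hom (specOver (Algebra.adjoin K (s₁ : Set B)) B).hom ≫
          Spec.map (CommRingCat.ofHom (algebraMap K B)) := by
      rw [← he₂]
      simp only [Category.assoc, Iso.inv_hom_id_assoc]
      rfl
    change (e.inv ≫ a ≫ pullback.fst X₀.hom (specOver K B).hom) ≫ X₀.hom = _
    simp only [Category.assoc]
    rw [h1, h2, h3]
  obtain ⟨t, g₀, hg₀, hg₀'⟩ := SubalgApprox.exists_π_app_comp_eq (∅ : Finset B) P₁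
    (Spec.map (CommRingCat.ofHom (algebraMap K (Algebra.adjoin K (s₁ : Set B))))) X₀.hom a' ha'
  -- the stage ring `R = R₁[t]`, of finite type over `K`, inside `B`
  let Rt : Subalgebra (Algebra.adjoin K (s₁ : Set B)) B :=
    SubalgApprox.sub (Algebra.adjoin K (s₁ : Set B)) B t.unop.1
  let T : SchemeOver (Algebra.adjoin K (s₁ : Set B)) :=
    (SubalgApprox.baseDiagram (Algebra.adjoin K (s₁ : Set B)) B ∅).obj t
  have hT : T = specOver (Algebra.adjoin K (s₁ : Set B)) Rt := rfl
  let ψ : Rt →ₐ[K] B := (Rt.val).restrictScalars K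
  haveI : Algebra.FiniteType (Algebra.adjoin K (s₁ : Set B)) Rt :=
    SubalgApprox.finiteType_sub _ B t.unop.1
  haveI : Algebra.FiniteType K (Algebra.adjoin K (s₁ : Set B)) :=
    ⟨(Subalgebra.fg_top _).mpr ⟨s₁, rfl⟩⟩
  -- 4. the spread morphism `G = (g₀, pr₂) : X₁ ×_{R₁} Spec R → X₀ ×_K Spec R`
  let X' : Scheme.{u} := (P₁ ⊗ T).left
  have hcompat : g₀ ≫ X₀.hom = (pullback.snd P₁.hom T.hom ≫
      Spec.map (CommRingCat.ofHom (algebraMap (Algebra.adjoin K (s₁ : Set B)) Rt))) ≫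
        Spec.map (CommRingCat.ofHom (algebraMap K (Algebra.adjoin K (s₁ : Set B)))) := by
    rw [hg₀', Over.tensorObj_hom]
    simp only [Category.assoc, pullback.condition_assoc]
    rfl
  have hRalg : Spec.map (CommRingCat.ofHom (algebraMap (Algebra.adjoin K (s₁ : Set B)) Rt)) ≫
      Spec.map (CommRingCat.ofHom (algebraMap K (Algebra.adjoin K (s₁ : Set B)))) =
        (specOver K Rt).hom := by
    change _ = Spec.map (CommRingCat.ofHom (algebraMap K Rt))
    rw [← Spec.map_comp, ← CommRingCat.ofHom_comp, ← IsScalarTower.algebraMap_eq K _ Rt]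
  let G : X' ⟶ (X₀ ⊗ specOver K Rt).left :=
    pullback.lift g₀ (pullback.snd P₁.hom T.hom) (by rw [hcompat, Category.assoc, hRalg])
  have hG₁ : G ≫ pullback.fst _ _ = g₀ := pullback.lift_fst _ _ _
  have hG₂ : G ≫ pullback.snd _ _ = pullback.snd P₁.hom T.hom := pullback.lift_snd _ _ _
  -- the base change map `ℓ : X₀ ×_K Spec B → X₀ ×_K Spec R`
  have hψ : Spec.map (CommRingCat.ofHom ψ.toRingHom) ≫ (specOver K Rt).hom = (specOver K B).hom := by
    change Spec.map (CommRingCat.ofHom (algebraMap Rt B)) ≫ Spec.map (CommRingCat.ofHom (algebraMap K Rt)) =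
      Spec.map (CommRingCat.ofHom (algebraMap K B))
    rw [← Spec.map_comp, ← CommRingCat.ofHom_comp, ← IsScalarTower.algebraMap_eq K Rt B]
  let ι : specOver K B ⟶ specOver K Rt := Over.homMk (Spec.map (CommRingCat.ofHom ψ.toRingHom)) hψ
  let ℓ : (X₀ ⊗ specOver K B).left ⟶ (X₀ ⊗ specOver K Rt).left := (X₀ ◁ ι).left
  have hℓ₁ : ℓ ≫ pullback.fst _ _ = pullback.fst _ _ := Over.whiskerLeft_left_fst ι
  have hℓ₂ : ℓ ≫ pullback.snd _ _ = pullback.snd _ _ ≫ Spec.map (CommRingCat.ofHom ψ.toRingHom) :=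
    Over.whiskerLeft_left_snd ι
  have hℓ : IsPullback ℓ (pullback.snd X₀.hom (specOver K B).hom) (pullback.snd X₀.hom (specOver K Rt).hom)
      (Spec.map (CommRingCat.ofHom ψ.toRingHom)) := SubalgApprox.isPullback_whiskerLeft_left X₀ ι
  -- the stage projection `X → X'` is the base change of `Spec B → Spec R`
  let leg : specOver (Algebra.adjoin K (s₁ : Set B)) B ⟶ T :=
    (SubalgApprox.baseCone (Algebra.adjoin K (s₁ : Set B)) B ∅).π.app t
  have hleg : leg.left = Spec.map (CommRingCat.ofHom ψ.toRingHom) := rfl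
  have hπt : c.π.app t = (P₁ ◁ leg).left := rfl
  have hc2 : IsPullback (c.π.app t) (pullback.snd P₁.hom (specOver _ B).hom)
      (pullback.snd P₁.hom T.hom) leg.left :=
    SubalgApprox.isPullback_whiskerLeft_left P₁ leg
  let π : X ⟶ X' := e.hom ≫ c.π.app t
  have hbig : IsPullback π g (pullback.snd P₁.hom T.hom) (Spec.map (CommRingCat.ofHom ψ.toRingHom)) := by
    have he : IsPullback e.hom (e.hom ≫ pullback.snd _ _)
        (pullback.snd P₁.hom ((SubalgApprox.baseCone (Algebra.adjoin K (s₁ : Set B)) B ∅).pt).hom)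
        (𝟙 _) :=
      IsPullback.of_horiz_isIso ⟨by rw [Category.comp_id]⟩
    have h12 := he.paste_horiz hc2
    rw [Category.id_comp, he₂, hleg] at h12
    exact h12
  -- the square `(π, a; G, ℓ)` commutes
  have hcomm : π ≫ G = a ≫ ℓ := by
    apply pullback.hom_ext
    · calc (π ≫ G) ≫ pullback.fst X₀.hom (specOver K Rt).hom = π ≫ g₀ := by rw [Category.assoc, hG₁]
        _ = e.hom ≫ a' := by
            change e.hom ≫ (c.π.app t ≫ g₀) = _
            exact congrArg (e.hom ≫ ·) hg₀
        _ = a ≫ pullback.fst X₀.hom (specOver K B).hom := by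
            simp only [a', Iso.hom_inv_id_assoc]
        _ = (a ≫ ℓ) ≫ pullback.fst X₀.hom (specOver K Rt).hom := by rw [Category.assoc, hℓ₁]
    · calc (π ≫ G) ≫ pullback.snd X₀.hom (specOver K Rt).hom = π ≫ pullback.snd P₁.hom T.hom := by
            rw [Category.assoc, hG₂]
        _ = g ≫ Spec.map (CommRingCat.ofHom ψ.toRingHom) := hbig.w
        _ = a ≫ pullback.snd X₀.hom (specOver K B).hom ≫ Spec.map (CommRingCat.ofHom ψ.toRingHom) := by
            simp only [g, Category.assoc]
        _ = (a ≫ ℓ) ≫ pullback.snd X₀.hom (specOver K Rt).hom := by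
            rw [Category.assoc, hℓ₂]
  refine ⟨Rt, inferInstance, inferInstance, ψ, X', G, π, ℓ, ?_, ?_, ?_, ?_, ?_, hℓ₁, hℓ₂, ?_⟩
  · exact fun x y h ↦ Subtype.ext h
  · exact Algebra.FiniteType.trans (S := Algebra.adjoin K (s₁ : Set B)) inferInstance inferInstance
  · -- `G` is separated: `G ≫ pr₂ = pr₂` is separated
    haveI : IsSeparated (G ≫ pullback.snd X₀.hom (specOver K Rt).hom) := by
      rw [hG₂]; infer_instance
    exact IsSeparated.of_comp G (pullback.snd X₀.hom (specOver K Rt).hom)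
  · haveI : LocallyOfFiniteType (G ≫ pullback.snd X₀.hom (specOver K Rt).hom) := by
      rw [hG₂]; infer_instance
    exact locallyOfFiniteType_of_comp G (pullback.snd X₀.hom (specOver K Rt).hom)
  · haveI : QuasiCompact (G ≫ pullback.snd X₀.hom (specOver K Rt).hom) := by
      rw [hG₂]; infer_instance
    haveI : QuasiSeparated (pullback.snd X₀.hom (specOver K Rt).hom) := inferInstance
    exact QuasiCompact.of_comp G (pullback.snd X₀.hom (specOver K Rt).hom)
  · -- cartesian: `X' ×_{X₀ × Spec R} (X₀ × Spec B) = X' ×_{Spec R} Spec B = X`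
    refine IsPullback.of_bot ?_ hcomm hℓ
    rw [hG₂]
    exact hbig

end Literature.AlgebraicGeometry.Limits

end
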